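import Summits.RiemannHypothesis.RiemannHypothesis.Theorems.SignConeSignConeOscillatoryExtremalNonnegApprox
import Summits.RiemannHypothesis.RiemannHypothesis.Theorems.SignConeSignConeOscillatoryStubExtremalExists

/-!
# Line `dual_witness` of crux `SignConeOscillatory` (stmt-RiemannHypothesis-16302): **X₂ ⇔ crux**, and the KKT value is the
# cone value

**Theorem 1** (`isExtremalKKT_value`, unconditional).  Every KKT-extremal configuration `IsExtremalKKT a μ N c f` at a cutoff
`a > 0` has `μ = coneValue a` (= `m(a)`, the sign-cone value).  (`μ ≤ m(a)`: the lower bound (i) tested on admissible single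
tests.  `μ ≥ m(a)`: the node multipliers `l ≥ 0` of `shifted_multipliers` for the slack `1 − m(a)` — whose hypothesis is the
Boas–Kac key inequality — tested on the window approximants `wₙ → f` of `exists_window_test_approx` give in the limit
`0 ≤ Σ lₙ Re (f⋆f̃)(log n) ≤ reWar (f⋆f̃) + 1 − m(a) = μ − m(a)`.)

**Theorem 2** (`signConeExtremalNonneg_iff_signConeOscillatory`).  `SignConeExtremalNonneg ↔ SignConeOscillatory`: the
RH-strength stub X₂ of line `dual_witness` IS the crux (by Theorem 1, the landed `stub_extremalExists` and
`signConeOscillatory_iff_coneValue_nonneg`).  This is the mechanical form of the crux strategist's verdict (STRATEGY-CENSUS r1,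
§1.D5: "P says the minimum of the SAME functional is ≥ 0, read at the argmin") for the dual-witness split: the line cannot
lower the crux.
-/

noncomputable section

-- `Summit.RiemannHypothesis.RiemannHypothesis.…` repeats a namespace component by design (D-0017 layout).
set_option linter.dupNamespace false

open scoped BigOperators ComplexConjugate Topology
open MeasureTheory Set Filter Complex

namespace Summit.RiemannHypothesis.RiemannHypothesis.Theorems.SignCone.DualWitness

open Literature.NumberTheory.LFunctions Literature.Analysis.SpecialFunctions
open Summit.RiemannHypothesis.RiemannHypothesis.Theses.SignCone

set_option quotPrecheck false in -- the notation body has binders; it is a closed term over this file's `open`s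
/-- X₂ of line `dual_witness`, VERBATIM the body of the workfile's `def SignConeExtremalNonneg : Prop` (as in
`…StubExtremalExists.lean`). -/
local notation "SignConeExtremalNonneg" =>
  ∀ a μ : ℝ, 0 < a → ∀ (N : ℕ) (c : ℕ → ℝ) (f : ℝ → ℂ), IsExtremalKKT a μ N c f → 0 ≤ μ

/-- **The KKT value is the cone value** (unconditional): `IsExtremalKKT a μ N c f → μ = coneValue a`. [folklore] -/
theorem isExtremalKKT_value {a μ : ℝ} (ha : 0 < a) {N : ℕ} {c : ℕ → ℝ} {f : ℝ → ℂ} (hK : IsExtremalKKT a μ N c f) :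
    μ = coneValue a := by
  obtain ⟨-, -, hlb, ⟨hf2, hfs, hf0, hfnodes, hint, hμ⟩, -, -⟩ := hK
  set m : ℝ := coneValue a with hm
  -- `μ ≤ m`: the lower bound (i) on admissible single tests
  have hle : μ ≤ m := by
    refine le_csInf (valueSet_nonempty ha) ?_
    rintro x ⟨g, hg, rfl⟩
    have e : coneSum 1 (fun _ => g) = autocorr g := by funext t; simp [coneSum]
    have h1 := hlb 1 (fun _ => g) (fun _ => ⟨hg.1, hg.2.1⟩) (fun n hn => by rw [e]; exact hg.2.2.2 n hn)
    rw [e, autocorr_zero_re, hg.2.2.1, mul_one] at h1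
    linarith
  -- `m ≤ μ`: multipliers for the slack `1 - m`, tested on window approximants of `f`
  have hn1 : ∫ x, ‖f x‖ ^ 2 = 1 := by rw [← autocorr_zero_re]; exact hf0
  have hfi : Integrable f := integrable_of_memLp_two_of_support hf2 hfs
  have hE : Integrable fun t : ℝ => ‖weilMellin f (1 / 2 + t * I)‖ ^ 2 * reDigammaQuarter t := by
    have e : archIntegrand (autocorr f) = fun t : ℝ => ((‖weilMellin f (1 / 2 + t * I)‖ ^ 2 * reDigammaQuarter t : ℝ) : ℂ) := by
      funext t
      simp only [archIntegrand, mellinShift_eq_weilMellin]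
      rw [weilMellin_autocorr_half hfi t]
      unfold reDigammaQuarter
      push_cast; ring
    rw [e] at hint
    refine hint.re.congr (Eventually.of_forall fun t => ?_)
    exact RCLike.ofReal_re_ax _
  obtain ⟨w, hw, hnode, hreWar⟩ := exists_window_test_approx ha hf2 hfs hn1 hE
  obtain ⟨l, hl0, hl⟩ := shifted_multipliers a (1 - m) ha (fun k gf hgf hnodes => by
    have hkey := key_ineq ha (k := k) (g := gf) hgf hnodes
    have e0 : (∑ i, weilConv (gf i) (weilReflect (gf i)) 0).re = (coneSum k gf 0).re := rfl
    have eF : (fun t => ∑ i, weilConv (gf i) (weilReflect (gf i)) t) = coneSum k gf := rfl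
    rw [eF, e0, ← reWar_eq]
    linarith)
  set N' : ℕ := ⌈Real.exp (2 * a)⌉₊ with hN'
  have hineq : ∀ n, ∑ k ∈ Finset.Ico 2 N', l k * (autocorr (w n) (Real.log k)).re ≤ reWar (autocorr (w n)) + (1 - m) * 1 := by
    intro n
    have h := hl (w n) (hw n).1 (hw n).2.1
    rwa [← autocorr_eq_weilConv, ← reWar_eq, autocorr_zero_re, (hw n).2.2] at h
  have hlimL : Tendsto (fun n => ∑ k ∈ Finset.Ico 2 N', l k * (autocorr (w n) (Real.log k)).re) atTop
      (𝓝 (∑ k ∈ Finset.Ico 2 N', l k * (autocorr f (Real.log k)).re)) :=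
    tendsto_finsetSum _ fun k _ => ((continuous_re.tendsto _).comp (hnode _)).const_mul _
  have hlimR : Tendsto (fun n => reWar (autocorr (w n)) + (1 - m) * 1) atTop (𝓝 (reWar (autocorr f) + (1 - m) * 1)) :=
    hreWar.add_const _
  have hlim := le_of_tendsto_of_tendsto' hlimL hlimR hineq
  have hnn : 0 ≤ ∑ k ∈ Finset.Ico 2 N', l k * (autocorr f (Real.log k)).re :=
    Finset.sum_nonneg fun k hk => mul_nonneg (hl0 k) (hfnodes k (Finset.mem_Ico.mp hk).1)
  have hge : m ≤ μ := by linarith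
  exact le_antisymm hle hge

/-- **X₂ ⇔ crux**: `SignConeExtremalNonneg ↔ SignConeOscillatory`. [folklore] -/
theorem signConeExtremalNonneg_iff_signConeOscillatory : SignConeExtremalNonneg ↔ SignConeOscillatory := by
  constructor
  · exact signConeOscillatory_of_extremalNonneg
  · intro h a μ ha N c f hK
    rw [isExtremalKKT_value ha hK]
    exact signConeOscillatory_iff_coneValue_nonneg.mp h a ha

/-- Hence the KKT-extremal configuration of `stub_extremalExists` has value exactly `m(a)`:
`∃ N c f, IsExtremalKKT a (coneValue a) N c f`. [folklore] -/
theorem exists_isExtremalKKT_coneValue {a : ℝ} (ha : 0 < a) : ∃ (N : ℕ) (c : ℕ → ℝ) (f : ℝ → ℂ), IsExtremalKKT a (coneValue a) N c f := by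
  obtain ⟨μ, N, c, f, hK⟩ := stub_extremalExists a ha
  exact ⟨N, c, f, isExtremalKKT_value ha hK ▸ hK⟩

/-- `P_c^{(N)}(F) ≥ 0` for nonnegative fake primes `c` on a node-nonnegative `F`. [folklore] -/
theorem fakePrimeSum_nonneg {c : ℕ → ℝ} (hc : ∀ n, 0 ≤ c n) (N : ℕ) {F : ℝ → ℂ}
    (hF : ∀ n : ℕ, 2 ≤ n → 0 ≤ (F (Real.log n)).re) : 0 ≤ fakePrimeSum c N F := by
  unfold fakePrimeSum
  refine Finset.sum_nonneg fun n hn => mul_nonneg (div_nonneg (hc n) (Real.sqrt_nonneg _)) ?_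
  exact mul_nonneg (by norm_num) (hF n (Finset.mem_Icc.mp hn).1)

/-- **The crux is a fake explicit-formula inequality.** `SignConeOscillatory` holds iff for every cutoff `a > 0` there are
a level `N` and NONNEGATIVE fake von Mangoldt weights `c` on the nodes `2 ≤ n ≤ N` such that "Weil's inequality with fake
primes" `P_c^{(N)}(g ⋆ g̃) ≤ Re W_ar(g ⋆ g̃) + (g ⋆ g̃)(0)` holds for EVERY smooth test `g` supported in `[-a, a]`
(no sign condition on the test).  Under RH the true primes are such a certificate (explicit formula); unconditionally the
certificate at level `μ = m(a)` is the KKT multiplier of `exists_isExtremalKKT_coneValue`. [folklore] -/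
theorem signConeOscillatory_iff_exists_fakePrime_certificate :
    SignConeOscillatory ↔ ∀ a : ℝ, 0 < a → ∃ (N : ℕ) (c : ℕ → ℝ), (∀ n, 0 ≤ c n) ∧
      ∀ g : ℝ → ℂ, (ContDiff ℝ ((⊤ : ℕ∞) : WithTop ℕ∞) g ∧ HasCompactSupport g) → tsupport g ⊆ Set.Icc (-a) a →
        fakePrimeSum c N (autocorr g) ≤ reWar (autocorr g) + (autocorr g 0).re := by
  rw [signConeOscillatory_iff_coneValue_nonneg]
  constructor
  · intro h a ha
    obtain ⟨N, c, f, hK⟩ := exists_isExtremalKKT_coneValue ha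
    obtain ⟨-, hc, -, -, hdual, -⟩ := hK
    refine ⟨N, c, hc, fun g hg hga => (hdual g hg hga).trans ?_⟩
    have h0 : 0 ≤ (autocorr g 0).re := by
      rw [autocorr_zero_re]; exact integral_nonneg fun x => by positivity
    nlinarith [h a ha]
  · intro h a ha
    obtain ⟨N, c, hc, hdual⟩ := h a ha
    refine le_csInf (valueSet_nonempty ha) ?_
    rintro x ⟨g, hg, rfl⟩
    have h1 := hdual g hg.1 hg.2.1
    have h2 := fakePrimeSum_nonneg hc N hg.2.2.2
    rw [autocorr_zero_re, hg.2.2.1] at h1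
    linarith

end Summit.RiemannHypothesis.RiemannHypothesis.Theorems.SignCone.DualWitness

end
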